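import Summits.Ventures.LatticeQCDFlow.Exactness.IMHDirichletForm
import HarnessLib

/-!
# The variational bound `2⟨g, v⟩ − 𝓔(v) ≤ (∫ g² w/ρ)/ā` and the Dirichlet form of Neumann sums

HONEST FRAMING: exact (Metropolis-corrected) sampling algorithms for lattice gauge theory;
figures of merit are autocorrelation/cost numbers at stated couplings and volumes; no
continuum-physics claim.  (SCALAR calibration rung S0-A: not a gauge result.)

Venture `LatticeQCDFlow` (cell pub-lqcd), topic `Exactness`; FANOUT row 2 (`s0-phi4`, FLOW arm).
NEW WORK of the cell (pointwise AM–GM against `ā ρ`; finite-sum algebra of autocovariances),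
the two inputs of the acceptance-weighted ceiling `IMHTauIntLeAcceptanceCeiling.lean`.  Nothing
is cited as a fact.

## What is proved (`w, q > 0` measurable integrable, `∫ q = 1`, `Z = ∫ w`, `b = w/q`,
`W₂ = ∫ b w < ∞`, `ρ(t) = 1 − λ(b(t))`; `K = imhOp μ w q`, `C(k) = ∫ g (Kᵏ g) w`)

* **`two_inner_sub_dirichlet_le`** — for bounded measurable `v` and bounded measurable CENTRED
  `g`: `2∫ g v w − (∫ v² w − ∫ v (Kv) w) ≤ (∫ g² w/ρ) · Z/∫ρw` (uses `dirichlet_ge`);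
* `neumannSum_facts` — the partial Neumann sums `v_N = Σ_{k≤N} Kᵏ g` are bounded measurable with
  `K v_N = Σ_{k≤N} K^{k+1} g`;
* **`dirichlet_neumannSum_le`** — `∫ v_N² w − ∫ v_N (K v_N) w = Σ_{j≤N} (C(j) − C(j+N+1)) ≤ Σ_{k≤N} C(k)`
  (two-time form + telescoping + `C ≥ 0`).

NOT CLAIMED: anything numerical; HMC / local Metropolis.
-/

namespace Summit.Ventures.LatticeQCDFlow.Exactness

open Real MeasureTheory Filter Set Topology
open Summit.Ventures.LatticeQCDFlow.Scoring

variable {X : Type*} [MeasurableSpace X] {μ : Measure X} {w q : X → ℝ}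

variable [SFinite μ]

/-- **`2⟨g, v⟩_w − 𝓔(v) ≤ (∫ g² w/ρ) · Z/∫ρw`** for every bounded measurable `v` and every bounded
measurable CENTRED `g` (square-integrable weights): the variational upper bound behind the
acceptance-weighted ceiling on `τ_int` (pointwise AM–GM against `ā ρ`, then `dirichlet_ge`). -/
theorem two_inner_sub_dirichlet_le (hw0 : ∀ t, 0 < w t) (hwm : Measurable w)
    (hwi : Integrable w μ) (hq0 : ∀ t, 0 < q t) (hqm : Measurable q) (hqi : Integrable q μ)
    (hq1 : ∫ z, q z ∂μ = 1) (hW₂ : Integrable (fun x => w x / q x * w x) μ) {g : X → ℝ}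
    (hgm : Measurable g) {B : ℝ} (hgb : ∀ t, |g t| ≤ B) (hg0 : ∫ x, g x * w x ∂μ = 0)
    {v : X → ℝ} (hvm : Measurable v) {Bv : ℝ} (hvb : ∀ t, |v t| ≤ Bv) :
    2 * (∫ t, g t * v t * w t ∂μ) - ((∫ t, v t ^ 2 * w t ∂μ) - ∫ t, v t * imhOp μ w q v t * w t ∂μ)
      ≤ (∫ t, g t ^ 2 * w t / (1 - rejCurve μ w q (w t / q t)) ∂μ)
          * ((∫ z, w z ∂μ) / ∫ t, (1 - rejCurve μ w q (w t / q t)) * w t ∂μ) := by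
  set Z : ℝ := ∫ z, w z ∂μ with hZdef
  have hZ : 0 < Z := integral_pos_of_pos hw0 hwi hq1
  set ρ : X → ℝ := fun t => (1 - rejCurve μ w q (w t / q t)) with hρdef
  have hρm : Measurable ρ := measurable_const.sub ((measurable_rejCurve hwm hqm).comp (hwm.div hqm))
  have hρ01 : ∀ t, 0 < ρ t ∧ ρ t ≤ 1 := fun t =>
    ⟨(acc_mul_weight_le hw0 hwm hwi hq0 hqm hqi hq1 t).2.1, (acc_mul_weight_le hw0 hwm hwi hq0 hqm hqi hq1 t).2.2⟩
  -- the moments `P = ∫ ρ w`, `M₁ = ∫ ρ w v`, `M₂ = ∫ ρ w v²`, `G₂ = ∫ g² w/ρ`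
  have hρw : ∀ {h : X → ℝ} (hhm : Measurable h) {Bh : ℝ} (hhb : ∀ t, |h t| ≤ Bh),
      Integrable (fun t => ρ t * w t * h t) μ := by
    intro h hhm Bh hhb
    refine (integrable_mul_mul_weight (Ba := 1) hw0 hwm hwi hρm hhm (fun t => ?_) hhb).congr
      (Eventually.of_forall fun t => by ring)
    rw [abs_of_pos (hρ01 t).1]; exact (hρ01 t).2
  have hv2m : Measurable fun t => v t ^ 2 := hvm.pow_const 2
  have hv2b : ∀ t, |v t ^ 2| ≤ Bv ^ 2 := fun t => by
    rw [abs_pow]; exact pow_le_pow_left₀ (abs_nonneg _) (hvb t) 2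
  have i0 : Integrable (fun t => ρ t * w t * (1:ℝ)) μ := hρw (Bh := 1) measurable_const (fun t => by simp)
  have i1 : Integrable (fun t => ρ t * w t * v t) μ := hρw hvm hvb
  have i2 : Integrable (fun t => ρ t * w t * v t ^ 2) μ := hρw hv2m hv2b
  set P : ℝ := ∫ t, ρ t * w t ∂μ with hPdef
  set M₁ : ℝ := ∫ t, ρ t * w t * v t ∂μ with hM₁
  set M₂ : ℝ := ∫ t, ρ t * w t * v t ^ 2 ∂μ with hM₂
  set G₂ : ℝ := ∫ t, g t ^ 2 * w t / ρ t ∂μ with hG₂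
  have hP : 0 < P := integral_pos_of_pos (fun t => mul_pos (hρ01 t).1 (hw0 t)) (i0.congr
    (Eventually.of_forall fun t => mul_one _)) hq1
  set a : ℝ := P / Z with hadef
  have ha : 0 < a := div_pos hP hZ
  set c : ℝ := M₁ / P with hcdef
  -- (1) `2 ∫ g v w = 2 ∫ g (v − c) w` (centred `g`)
  have hgvw : Integrable (fun t => g t * v t * w t) μ := integrable_mul_mul_weight hw0 hwm hwi hgm hvm hgb hvb
  have hgw : Integrable (fun t => g t * w t) μ :=
    (integrable_mul_mul_weight hw0 hwm hwi hgm measurable_const hgb (fun t => (le_refl |(1:ℝ)|))).congr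
      (Eventually.of_forall fun t => by simp)
  have e1 : ∫ t, g t * v t * w t ∂μ = ∫ t, g t * (v t - c) * w t ∂μ := by
    have e : ∀ t, g t * (v t - c) * w t = g t * v t * w t - c * (g t * w t) := fun t => by ring
    simp_rw [e]
    rw [integral_sub hgvw (hgw.const_mul c), integral_const_mul, hg0, mul_zero, sub_zero]
  -- (2) pointwise AM–GM: `2 g (v − c) w ≤ g² w/(a ρ) + a ρ w (v − c)²`
  have hG₂i : Integrable (fun t => g t ^ 2 * w t / ρ t) μ :=
    integrable_sq_mul_weight_div_acc hw0 hwm hwi hq0 hqm hqi hq1 hW₂ hgm hgb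
  have hvc_m : Measurable fun t => (v t - c) ^ 2 := (hvm.sub measurable_const).pow_const 2
  have hvc1 : ∀ t, |v t - c| ≤ Bv + |c| := fun t => (abs_sub (v t) c).trans (by linarith [hvb t])
  have hvc_b : ∀ t, |(v t - c) ^ 2| ≤ (Bv + |c|) ^ 2 := fun t => by
    rw [abs_pow]
    exact pow_le_pow_left₀ (abs_nonneg _) (hvc1 t) 2
  have i3 : Integrable (fun t => ρ t * w t * (v t - c) ^ 2) μ := hρw hvc_m hvc_b
  have hamgm : ∀ t, 2 * (g t * (v t - c) * w t)
      ≤ (1 / a) * (g t ^ 2 * w t / ρ t) + a * (ρ t * w t * (v t - c) ^ 2) := by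
    intro t
    have hκ : 0 < a * ρ t := mul_pos ha (hρ01 t).1
    have hw := hw0 t
    -- `2xy ≤ x²/κ + κ y²` with `x = g`, `y = v − c`, `κ = a ρ`, times `w > 0`
    have hane : a ≠ 0 := ha.ne'
    have hρne : ρ t ≠ 0 := (hρ01 t).1.ne'
    have key : 2 * (g t * (v t - c)) ≤ g t ^ 2 / (a * ρ t) + a * ρ t * (v t - c) ^ 2 := by
      have hκne : a * ρ t ≠ 0 := hκ.ne'
      have h := div_nonneg (sq_nonneg (g t - a * ρ t * (v t - c))) hκ.le
      have e : (g t - a * ρ t * (v t - c)) ^ 2 / (a * ρ t)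
          = g t ^ 2 / (a * ρ t) + a * ρ t * (v t - c) ^ 2 - 2 * (g t * (v t - c)) := by
        field_simp
        ring
      linarith [e ▸ h]
    have := mul_le_mul_of_nonneg_right key hw.le
    have e2 : (g t ^ 2 / (a * ρ t) + a * ρ t * (v t - c) ^ 2) * w t
        = (1 / a) * (g t ^ 2 * w t / ρ t) + a * (ρ t * w t * (v t - c) ^ 2) := by
      field_simp
    rw [e2] at this
    linarith
  have h2 : 2 * ∫ t, g t * (v t - c) * w t ∂μ ≤ (1 / a) * G₂ + a * ∫ t, ρ t * w t * (v t - c) ^ 2 ∂μ := by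
    rw [← integral_const_mul, hG₂, ← integral_const_mul, ← integral_const_mul,
      ← integral_add (hG₂i.const_mul _) (i3.const_mul _)]
    have hgvc : Integrable (fun t => g t * (v t - c) * w t) μ :=
      integrable_mul_mul_weight hw0 hwm hwi hgm (hvm.sub measurable_const) hgb hvc1
    exact integral_mono (hgvc.const_mul 2) ((hG₂i.const_mul _).add (i3.const_mul _)) hamgm
  -- (3) `∫ ρ w (v − c)² = M₂ − M₁²/P`
  have h3 : ∫ t, ρ t * w t * (v t - c) ^ 2 ∂μ = M₂ - M₁ ^ 2 / P := by
    have e : ∀ t, ρ t * w t * (v t - c) ^ 2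
        = ρ t * w t * v t ^ 2 - 2 * c * (ρ t * w t * v t) + c ^ 2 * (ρ t * w t * 1) := fun t => by ring
    simp_rw [e]
    have k3 : Integrable (fun t => 2 * c * (ρ t * w t * v t)) μ := i1.const_mul _
    have k1 : Integrable (fun t => ρ t * w t * v t ^ 2 - 2 * c * (ρ t * w t * v t)) μ := i2.sub k3
    have k2 : Integrable (fun t => c ^ 2 * (ρ t * w t * 1)) μ := i0.const_mul _
    rw [integral_add k1 k2, integral_sub i2 k3, integral_const_mul, integral_const_mul, ← hM₂, ← hM₁]
    have eP : ∫ t, ρ t * w t * 1 ∂μ = P := by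
      rw [hPdef]; exact integral_congr_ae (Eventually.of_forall fun t => mul_one _)
    rw [eP, hcdef]
    field_simp
    ring
  -- (4) Dirichlet lower bound `𝓔(v) ≥ a M₂ − M₁²/Z = a (M₂ − M₁²/P)`
  have h4 := dirichlet_ge hw0 hwm hwi hq0 hqm hqi hq1 hvm hvb
  rw [← hZdef] at h4
  have eP' : (∫ t, (1 - rejCurve μ w q (w t / q t)) * w t ∂μ) = P := rfl
  have eM2 : (∫ t, (1 - rejCurve μ w q (w t / q t)) * w t * v t ^ 2 ∂μ) = M₂ := rfl
  have eM1 : (∫ t, (1 - rejCurve μ w q (w t / q t)) * w t * v t ∂μ) = M₁ := rfl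
  rw [eP', eM2, eM1] at h4
  have h4' : a * (M₂ - M₁ ^ 2 / P)
      ≤ (∫ t, v t ^ 2 * w t ∂μ) - ∫ t, v t * imhOp μ w q v t * w t ∂μ := by
    have e : a * (M₂ - M₁ ^ 2 / P) = P / Z * M₂ - M₁ ^ 2 / Z := by
      rw [hadef]
      have hPne := hP.ne'
      have hZne := hZ.ne'
      field_simp
    rw [e]; exact h4
  -- assemble
  rw [e1]
  have efin : G₂ * (Z / P) = (1 / a) * G₂ := by
    rw [hadef]
    have hPne := hP.ne'
    have hZne := hZ.ne'
    field_simp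
  rw [efin]
  rw [h3] at h2
  linarith

/-! ## The partial Green–Kubo sums against the variational bound -/

/-- The partial Neumann sums `v_N = Σ_{k≤N} Kᵏ g` are measurable, bounded, and
`K v_N = Σ_{k≤N} K^{k+1} g`. -/
theorem neumannSum_facts (hw0 : ∀ t, 0 < w t) (hwm : Measurable w) (hq0 : ∀ t, 0 < q t)
    (hqm : Measurable q) (hqi : Integrable q μ) (hq1 : ∫ z, q z ∂μ = 1) {g : X → ℝ}
    (hgm : Measurable g) {B : ℝ} (hgb : ∀ t, |g t| ≤ B) :
    ∀ N : ℕ, Measurable (fun x => ∑ k ∈ Finset.range (N + 1), ((imhOp μ w q)^[k] g) x)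
      ∧ (∀ x, |∑ k ∈ Finset.range (N + 1), ((imhOp μ w q)^[k] g) x| ≤ ((N : ℝ) + 1) * B)
      ∧ ∀ x, imhOp μ w q (fun y => ∑ k ∈ Finset.range (N + 1), ((imhOp μ w q)^[k] g) y) x
          = ∑ k ∈ Finset.range (N + 1), ((imhOp μ w q)^[k + 1] g) x
  | 0 => by
    refine ⟨by simpa using hgm, fun x => by simpa using hgb x, fun x => ?_⟩
    simp only [zero_add, Finset.range_one, Finset.sum_singleton, Function.iterate_zero, id_eq,
      Function.iterate_one]
  | N + 1 => by
    obtain ⟨hm, hb, hK⟩ := neumannSum_facts hw0 hwm hq0 hqm hqi hq1 hgm hgb N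
    obtain ⟨hNm, hNb⟩ := imhOp_iterate_bdd (μ := μ) hw0 hwm hq0 hqm hqi hq1 (N + 1) hgm hgb
    have e : ∀ x, ∑ k ∈ Finset.range (N + 1 + 1), ((imhOp μ w q)^[k] g) x
        = (∑ k ∈ Finset.range (N + 1), ((imhOp μ w q)^[k] g) x) + 1 * ((imhOp μ w q)^[N + 1] g) x :=
      fun x => by rw [Finset.sum_range_succ, one_mul]
    refine ⟨?_, fun x => ?_, fun x => ?_⟩
    · exact Finset.measurable_sum _ fun k _ => (imhOp_iterate_bdd (μ := μ) hw0 hwm hq0 hqm hqi hq1 k hgm hgb).1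
    · rw [Finset.sum_range_succ]
      refine (abs_add_le _ _).trans ?_
      have h1 := hb x
      have h2 := hNb x
      push_cast
      linarith
    · have hfun : (fun y => ∑ k ∈ Finset.range (N + 1 + 1), ((imhOp μ w q)^[k] g) y)
          = fun y => (∑ k ∈ Finset.range (N + 1), ((imhOp μ w q)^[k] g) y)
            + 1 * ((imhOp μ w q)^[N + 1] g) y := funext e
      rw [hfun, imhOp_add_mul hw0 hwm hq0 hqm hqi hm hNm hb hNb 1 x, hK x,
        Finset.sum_range_succ (fun k => ((imhOp μ w q)^[k + 1] g) x) (N + 1), one_mul,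
        Function.iterate_succ_apply' (imhOp μ w q) (N + 1) g]

/-- **The Dirichlet form of a partial Neumann sum is below the partial Green–Kubo sum**:
with `v_N = Σ_{k≤N} Kᵏ g` and `C(k) = ∫ g (Kᵏ g) w`,
`∫ v_N² w − ∫ v_N (K v_N) w = Σ_{j≤N} (C(j) − C(j+N+1)) ≤ Σ_{k≤N} C(k)`. -/
theorem dirichlet_neumannSum_le (hw0 : ∀ t, 0 < w t) (hwm : Measurable w) (hwi : Integrable w μ)
    (hq0 : ∀ t, 0 < q t) (hqm : Measurable q) (hqi : Integrable q μ) (hq1 : ∫ z, q z ∂μ = 1)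
    {g : X → ℝ} (hgm : Measurable g) {B : ℝ} (hgb : ∀ t, |g t| ≤ B) (N : ℕ) :
    (∫ t, (∑ k ∈ Finset.range (N + 1), ((imhOp μ w q)^[k] g) t) ^ 2 * w t ∂μ)
      - ∫ t, (∑ k ∈ Finset.range (N + 1), ((imhOp μ w q)^[k] g) t)
          * imhOp μ w q (fun y => ∑ k ∈ Finset.range (N + 1), ((imhOp μ w q)^[k] g) y) t * w t ∂μ
      ≤ ∑ k ∈ Finset.range (N + 1), ∫ t, g t * ((imhOp μ w q)^[k] g) t * w t ∂μ := by
  obtain ⟨hm, hb, hK⟩ := neumannSum_facts hw0 hwm hq0 hqm hqi hq1 hgm hgb N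
  set C : ℕ → ℝ := fun k => ∫ t, g t * ((imhOp μ w q)^[k] g) t * w t ∂μ with hCdef
  have two := integral_iterate_mul_iterate hw0 hwm hwi hq0 hqm hqi hq1 hgm hgb
  have hterm : ∀ j k, Integrable (fun t => ((imhOp μ w q)^[j] g) t * ((imhOp μ w q)^[k] g) t * w t) μ :=
    fun j k => by
      obtain ⟨hjm, hjb⟩ := imhOp_iterate_bdd (μ := μ) hw0 hwm hq0 hqm hqi hq1 j hgm hgb
      obtain ⟨hkm, hkb⟩ := imhOp_iterate_bdd (μ := μ) hw0 hwm hq0 hqm hqi hq1 k hgm hgb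
      exact integrable_mul_mul_weight hw0 hwm hwi hjm hkm hjb hkb
  -- `∫ v_N² w = Σ_j Σ_k C(j+k)`
  have hsq : ∫ t, (∑ k ∈ Finset.range (N + 1), ((imhOp μ w q)^[k] g) t) ^ 2 * w t ∂μ
      = ∑ j ∈ Finset.range (N + 1), ∑ k ∈ Finset.range (N + 1), C (j + k) := by
    have e : ∀ t, (∑ k ∈ Finset.range (N + 1), ((imhOp μ w q)^[k] g) t) ^ 2 * w t
        = ∑ j ∈ Finset.range (N + 1), ∑ k ∈ Finset.range (N + 1),
            ((imhOp μ w q)^[j] g) t * ((imhOp μ w q)^[k] g) t * w t := by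
      intro t
      rw [sq, Finset.sum_mul_sum, Finset.sum_mul]
      refine Finset.sum_congr rfl fun j _ => ?_
      rw [Finset.sum_mul]
    simp_rw [e]
    rw [integral_finsetSum _ fun j _ => integrable_finsetSum _ fun k _ => hterm j k]
    refine Finset.sum_congr rfl fun j _ => ?_
    rw [integral_finsetSum _ fun k _ => hterm j k]
    refine Finset.sum_congr rfl fun k _ => ?_
    exact two j k
  -- `∫ v_N (K v_N) w = Σ_j Σ_k C(j+k+1)`
  have hK' : ∫ t, (∑ k ∈ Finset.range (N + 1), ((imhOp μ w q)^[k] g) t)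
        * imhOp μ w q (fun y => ∑ k ∈ Finset.range (N + 1), ((imhOp μ w q)^[k] g) y) t * w t ∂μ
      = ∑ j ∈ Finset.range (N + 1), ∑ k ∈ Finset.range (N + 1), C (j + k + 1) := by
    have e : ∀ t, (∑ k ∈ Finset.range (N + 1), ((imhOp μ w q)^[k] g) t)
        * imhOp μ w q (fun y => ∑ k ∈ Finset.range (N + 1), ((imhOp μ w q)^[k] g) y) t * w t
        = ∑ j ∈ Finset.range (N + 1), ∑ k ∈ Finset.range (N + 1),
            ((imhOp μ w q)^[j] g) t * ((imhOp μ w q)^[k + 1] g) t * w t := by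
      intro t
      rw [hK t, Finset.sum_mul_sum, Finset.sum_mul]
      refine Finset.sum_congr rfl fun j _ => ?_
      rw [Finset.sum_mul]
    simp_rw [e]
    rw [integral_finsetSum _ fun j _ => integrable_finsetSum _ fun k _ => hterm j (k + 1)]
    refine Finset.sum_congr rfl fun j _ => ?_
    rw [integral_finsetSum _ fun k _ => hterm j (k + 1)]
    refine Finset.sum_congr rfl fun k _ => ?_
    rw [two j (k + 1), ← add_assoc]
  rw [hsq, hK', ← Finset.sum_sub_distrib]
  refine Finset.sum_le_sum fun j _ => ?_
  -- telescoping in `k`: `Σ_k (C(j+k) − C(j+k+1)) = C(j) − C(j+N+1) ≤ C(j)`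
  rw [← Finset.sum_sub_distrib]
  have htel : ∑ k ∈ Finset.range (N + 1), (C (j + k) - C (j + k + 1)) = C j - C (j + (N + 1)) := by
    have h := Finset.sum_range_sub' (fun k => C (j + k)) (N + 1)
    simp only [add_zero] at h
    rw [← h]
    refine Finset.sum_congr rfl fun k _ => ?_
    rw [add_assoc]
  rw [htel]
  have h0 : 0 ≤ C (j + (N + 1)) := autocov_nonneg hw0 hwm hwi hq0 hqm hqi hq1 hgm hgb _
  linarith

end Summit.Ventures.LatticeQCDFlow.Exactness
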